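import Mathlib.MeasureTheory.Measure.MeasureSpace
import Mathlib.Analysis.SpecialFunctions.Log.Basic
import Summits.ABC.IUTFork.ForkBPS
import HarnessLib

/-!
# L-LANA objects V: `ℝ^ss = {regions}/(equal volume)`, the two `η`'s, and (9-1), over a measure space (LANA §9.2–9.3, (Ind3))

Record-only file (D-0012) of the abc-iut cell (seat abc-iut-c312-4, L-LANA level, plan/LLANA-SPEC N15 and
the shape of N14 Steps 7–9 / (Ind3)); TAKES NO SIDE on [IUTchIII] Cor. 3.12. `ForkEta.lean` (XV) typed the
main goal (9-1) over ABSTRACT data (a type of regions with a real-valued volume). This file makes the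
regions and volumes REAL: an arbitrary measure space `(Ω, μ)` stands for the large volume container
`VC(I_v)` with its procession-normalised measure (its construction is LLANA-SPEC N11 = L-DH D3/D4/D8, seat
abc-iut-c312-3; this file is agnostic about it), and everything below is Mathlib measure theory.
From Project LANA's interim report (bib `LANA2026Report`, read on the page):

* §9.2 p. 46: "`ℝ^ss = {T ⊂ VC(I_v) | adelic and measurable}/∼`, where `T ∼ T′` if and only if the volume of
  `T` coincides with that of `T′`; we define `M = 1·S` (the action of `1 ∈ ℕ`), which represents "`LGP·S`"
  (cf. §6.2 (h)), and put the class of `M` in `ℝ^ss` to be the pilot. Thus the isomorphism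
  `η^{anab}_S : ℝ^val ⥲ ℝ^ss` of the pointed real vector spaces depends on `S` … `η_q : ℝ^val ⥲ ℝ^ss`, where
  the pilot of the target `ℝ^ss` is given by the class of `{q̲_v O_v}` embedded "diagonally" into the large
  volume container `VC(I_v)`. … we wish to show that there exists some suitable `S` such that
  `η_q = η^{anab}_S`. (9-1)" — `Region`, `Region.logVol`, `Rss` (classes by EQUAL VOLUME, verbatim),
  `Rss.logVol` (injective: a class IS a log-volume), `EtaData` (`ℝ^val`, the `q`-region, `S ↦ LGP·S`, the
  suitable `S`), `EtaData.MainGoal` = (9-1) as printed, `eta` (the unique isomorphism of pointed lines onto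
  the log-volume line pointed by a region), `MainGoal ↔ ∃ suitable S, η_q = η^{anab}_S` (`mainGoal_iff_eta`)
  and `↔ equal log-volume` (`mainGoal_iff_logVol`).
* §9.3 p. 46: "(9-1) indicates that the starting point `η_q` belongs to an orbit … generated by the
  indeterminacies of the formation of `η^{anab}_S`. In other words, at the level of degree (log-volume), the
  rigidified `q`-pilot is represented in the output regions" and §8.3 p. 43 "`−|log(q)| ∈ ℝ_{≤ −|log(Θ)|}`":
  PROVED at measure level — `Region.logVol_mono` (bigger region, bigger log-volume) and
  `EtaData.cor312_of_mainGoal` (if (9-1) holds and every `LGP·S` lies in the hull region then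
  `−|log(q)| ≤ −|log(Θ)|`, the latter DEFINED as the hull's log-volume, §8.1 (h)).
* (Ind3) §6 p. 31: "it is not possible to reconstruct `VC(O)` … All we can say is that this is an adelic
  measurable subset of the log-shell version of the volume container … instead of just `VC(O)`, we must take
  into account all such subsets" — the family `EtaData.Suitable` of admissible `S` is hypothesis DATA (its
  description = `η`-algorithm Step 9, §9.1 (i), LLANA-SPEC N14); `not_mainGoal_of_suitable_empty` /
  `mainGoal_of_mem` are the vacuity checks (LANA Rem. 8.2.1 spirit): (9-1) is neither automatic nor
  impossible — it is exactly a statement about WHICH `S` are suitable.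

Modelling notes. (i) "adelic" (product structure over places) is not modelled: a region is a measurable
set of finite nonzero measure (so that its log-volume is a real number). (ii) LANA do not print the vector
space structure of `ℝ^ss`; a class is determined by its log-volume (`Rss.logVol_injective`), and the
"pointed real line" `ℝ^ss` pointed by `[T]` is typed as the log-volume line `ℝ` pointed by `log-vol(T)`
(`volLine`; `eta` requires `log-vol(T) ≠ 0` — pilots are "negative", Rem. 4.1.5; [IUTchIII] Cor. 3.12:
"`|log(q)| > 0`"); `ForkEta.eta_eq_iff` (XV) showed the typed (9-1) is insensitive to this choice.
NOT here: `VC(I_v)` itself, `LGP`, the hull as a construction, the `η`-algorithm Steps 2–8, any judgement.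
-/

noncomputable section

open MeasureTheory

namespace Summit.ABC
namespace IUTFork

/-! ## 1. Regions, log-volume, `ℝ^ss` (§9.2) -/

variable {Ω : Type} [MeasurableSpace Ω] (μ : Measure Ω)

/-- A REGION `T ⊂ VC(I_v)`: "adelic and measurable" — typed as a measurable subset of finite nonzero
measure (modelling note (i)). [cite: LANA2026Report, §9.2 p. 46] -/
structure Region where
  /-- the subset `T` -/
  carrier : Set Ω
  /-- "measurable" -/
  measurable : MeasurableSet carrier
  /-- nonzero volume -/
  vol_ne_zero : μ carrier ≠ 0
  /-- finite volume -/
  vol_ne_top : μ carrier ≠ ⊤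

namespace Region

variable {μ} (T T' : Region μ)

/-- The volume `vol(T)`. [cite: LANA2026Report, §5.2 (e) p. 29] -/
def vol : ENNReal := μ T.carrier

/-- §5.2 (e) p. 29: "we denote log-vol(`S`) the logarithm of the volume vol(`S`) (the log volume of `S`)".
[cite: LANA2026Report, §5.2 (e) p. 29] -/
def logVol : ℝ := Real.log (μ T.carrier).toReal

/-- The real volume of a region is positive. [folklore] -/
theorem toReal_vol_pos : 0 < (μ T.carrier).toReal := ENNReal.toReal_pos T.vol_ne_zero T.vol_ne_top

/-- Equal volume iff equal log-volume (volumes are finite and positive). [folklore] -/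
theorem vol_eq_iff_logVol_eq : T.vol = T'.vol ↔ T.logVol = T'.logVol := by
  rw [vol, vol, logVol, logVol, ← ENNReal.toReal_eq_toReal_iff' T.vol_ne_top T'.vol_ne_top]
  constructor
  · intro h; rw [h]
  · intro h; exact Real.log_injOn_pos T.toReal_vol_pos T'.toReal_vol_pos h

/-- **Monotonicity**: `T ⊆ T′ ⟹ log-vol(T) ≤ log-vol(T′)` — the measure-level fact behind "contains …
hence ≤" ([IUTchIII] Step (xi-f); LANA §8.3 "By the definition of `ℝ_{≤−|log(Θ)|}`").
[cite: LANA2026Report, §8.3 p. 43] -/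
theorem logVol_mono (h : T.carrier ⊆ T'.carrier) : T.logVol ≤ T'.logVol := by
  rw [logVol, logVol, Real.log_le_log_iff T.toReal_vol_pos T'.toReal_vol_pos]
  exact ENNReal.toReal_mono T'.vol_ne_top (measure_mono h)

end Region

/-- "`T ∼ T′` if and only if the volume of `T` coincides with that of `T′`". [cite: LANA2026Report, §9.2 p. 46] -/
def volSetoid : Setoid (Region μ) := Setoid.ker Region.vol

/-- **`ℝ^ss := {T ⊂ VC(I_v) | adelic and measurable}/∼`** ("ss" = "semi-simplification", footnote 10).
[cite: LANA2026Report, §9.2 p. 46] -/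
def Rss : Type := Quotient (volSetoid μ)

variable {μ}

/-- The class `[T] ∈ ℝ^ss` of a region. [cite: LANA2026Report, §9.2 p. 46] -/
def Region.cls (T : Region μ) : Rss μ := Quotient.mk (volSetoid μ) T

/-- `[T] = [T′] ⟺ vol(T) = vol(T′)`. [cite: LANA2026Report, §9.2 p. 46] -/
theorem Region.cls_eq_cls_iff (T T' : Region μ) : T.cls = T'.cls ↔ T.vol = T'.vol :=
  ⟨fun h => Quotient.exact h, fun h => Quotient.sound h⟩

/-- `[T] = [T′] ⟺ log-vol(T) = log-vol(T′)`. [cite: LANA2026Report, §9.2 p. 46] -/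
theorem Region.cls_eq_cls_iff_logVol (T T' : Region μ) : T.cls = T'.cls ↔ T.logVol = T'.logVol :=
  (T.cls_eq_cls_iff T').trans (T.vol_eq_iff_logVol_eq T')

/-- The log-volume of a class (well defined by the definition of `∼`). [cite: LANA2026Report, §9.2 p. 46] -/
def Rss.logVol : Rss μ → ℝ :=
  Quotient.lift Region.logVol fun T T' (h : T.vol = T'.vol) => (T.vol_eq_iff_logVol_eq T').mp h

/-- `log-vol([T]) = log-vol(T)`. [cite: LANA2026Report, §9.2 p. 46] -/
@[simp] theorem Rss.logVol_cls (T : Region μ) : Rss.logVol T.cls = T.logVol := rfl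

/-- A class in `ℝ^ss` IS a log-volume: `[T] ↦ log-vol(T)` is injective (modelling note (ii)).
[cite: LANA2026Report, §9.2 p. 46] -/
theorem Rss.logVol_injective : Function.Injective (Rss.logVol (μ := μ)) := by
  rintro ⟨T⟩ ⟨T'⟩ h
  exact Quotient.sound ((T.vol_eq_iff_logVol_eq T').mpr h)

/-! ## 2. `ℝ^ss` pointed by a region, and the `η`'s as isomorphisms of pointed lines (§9.2) -/

/-- The log-volume line `ℝ` pointed by a nonzero real number `r` (a `PointedLine` of `ForkBPS`, XIII): the
typed "pointed real vector space `ℝ^ss`" pointed by the class of a region of log-volume `r` (modelling note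
(ii)). [cite: LANA2026Report, §9.2 p. 46] -/
def volLine (r : ℝ) (hr : r ≠ 0) : PointedLine where
  C := ℝ
  rank_one := Module.finrank_self ℝ
  pilot := r
  pilot_ne := hr

/-- **`η : ℝ^val ⥲ ℝ^ss`**, the isomorphism "of the pointed real vector spaces" onto `ℝ^ss` pointed by `[T]`
(`log-vol(T) ≠ 0`): it EXISTS AND IS UNIQUE for every pointing (XIII `PointedLine.iso_nonempty` /
`iso_subsingleton`) — with `T = {q̲_v O_v}` this is `η_q`, with `T = 1·S = LGP·S` it is `η^{anab}_S`. What
distinguishes the `η`'s is only the pointing region. [cite: LANA2026Report, §9.2 p. 46] -/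
def eta (Rval : PointedLine) (T : Region μ) (hT : T.logVol ≠ 0) : Rval.C ≃ₗ[ℝ] ℝ :=
  (Classical.choice (PointedLine.iso_nonempty Rval (volLine T.logVol hT))).toEquiv

/-- `η` sends the pilot of `ℝ^val` to `log-vol(T)`, the pilot of `ℝ^ss`. [cite: LANA2026Report, §9.2 p. 46] -/
theorem eta_pilot (Rval : PointedLine) (T : Region μ) (hT : T.logVol ≠ 0) :
    eta Rval T hT Rval.pilot = T.logVol :=
  (Classical.choice (PointedLine.iso_nonempty Rval (volLine T.logVol hT))).map_pilot

/-- **Two `η`'s coincide iff their pointing regions have the same class in `ℝ^ss`.**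
[cite: LANA2026Report, §9.2 p. 46] -/
theorem eta_eq_eta_iff (Rval : PointedLine) (T T' : Region μ) (hT : T.logVol ≠ 0) (hT' : T'.logVol ≠ 0) :
    eta Rval T hT = eta Rval T' hT' ↔ T.cls = T'.cls := by
  rw [Region.cls_eq_cls_iff_logVol]
  constructor
  · intro h
    have h' := LinearEquiv.congr_fun h Rval.pilot
    rwa [eta_pilot, eta_pilot] at h'
  · intro h
    refine LinearEquiv.ext fun x => ?_
    obtain ⟨c, rfl⟩ := Rval.exists_smul_pilot x
    rw [map_smul, map_smul, eta_pilot, eta_pilot, h]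

/-! ## 3. (9-1) over these objects; (Ind3) as the datum "which `S` are suitable" -/

/-- The data of §9.2 at the level of this file: `ℝ^val` ("the `C` part of the original BPS"), the
`q`-region "`{q̲_v O_v}` embedded "diagonally" into the large volume container `VC(I_v)`", the map
`S ↦ 1·S` ("the action of `1 ∈ ℕ`", "represents "`LGP·S`"" — output of the `η`-algorithm Steps 7–8,
§9.1 (g)–(h), LLANA-SPEC N14), the SUITABLE `S` ((Ind1)/(Ind2)-orbit, (Ind3) "all such subsets", Step 9
§9.1 (i)), and the hull region `U^{hol}` of §8.1 (f) with `−|log(Θ)| := log-vol((U^{hol})^{det})` (§8.1 (h)).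
[cite: LANA2026Report, §9.2 p. 46, §9.1 (g)–(i) p. 45, §8.1 (f),(h) p. 41] -/
structure EtaData (μ : Measure Ω) : Type 1 where
  /-- `ℝ^val` -/
  Rval : PointedLine
  /-- `{q̲_v O_v}` embedded diagonally -/
  qRegion : Region μ
  /-- `S ↦ 1·S = LGP·S` -/
  LGP : Region μ → Region μ
  /-- the suitable integral structures `S ⊂ VC(I_v)` -/
  Suitable : Set (Region μ)
  /-- the holomorphic hull of the union of the possible images -/
  hull : Region μ

namespace EtaData

variable (E : EtaData μ)

/-- `−|log(q)|` := log-vol of the `q`-region (§8.1 (a): "computed in the usual way").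
[cite: LANA2026Report, §8.1 (a) p. 40] -/
def negAbsLogq : ℝ := E.qRegion.logVol

/-- `−|log(Θ)|` := log-vol of the hull (§8.1 (h) "The value log-vol(`(U^{hol})^{det}`) is `−|log(Θ)|`").
[cite: LANA2026Report, §8.1 (h) p. 41] -/
def negAbsLogTheta : ℝ := E.hull.logVol

/-- **THE MAIN GOAL (9-1), as printed**: "there exists some suitable `S` such that `η_q = η^{anab}_S`", the
two `η`'s being pinned by their pilots `[{q̲_v O_v}]`, resp. `[1·S]` in `ℝ^ss` — i.e. equality of the two
classes (`mainGoal_iff_eta` below recovers the printed form with the `η`'s). HYPOTHESIS ("we, the LANA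
project, do not have a proof of (9-1) at this time", §10.5 p. 49). [cite: LANA2026Report, §9.2 (9-1) p. 46] -/
@[cite "LANA2026Report" "§9.2 (9-1) p. 46"]
def MainGoal : Prop := ∃ S ∈ E.Suitable, E.qRegion.cls = (E.LGP S).cls

/-- (9-1) ⟺ some suitable `LGP·S` has the `q`-region's log-volume ("at the level of degree (log-volume),
the rigidified `q`-pilot is represented in the output regions", §9.3). [cite: LANA2026Report, §9.3 p. 46] -/
theorem mainGoal_iff_logVol : E.MainGoal ↔ ∃ S ∈ E.Suitable, (E.LGP S).logVol = E.qRegion.logVol := by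
  simp only [MainGoal, Region.cls_eq_cls_iff_logVol, eq_comm]

/-- **(9-1) with the `η`'s**: granted nonzero pilots (modelling note (ii)), `MainGoal ⟺ ∃ suitable S,
η_q = η^{anab}_S` as isomorphisms of pointed lines out of `ℝ^val` (compared as linear maps into the
log-volume line). [cite: LANA2026Report, §9.2 (9-1) p. 46] -/
theorem mainGoal_iff_eta (hq : E.qRegion.logVol ≠ 0) (hS : ∀ S ∈ E.Suitable, (E.LGP S).logVol ≠ 0) :
    E.MainGoal ↔ ∃ (S : Region μ) (h : S ∈ E.Suitable),
      eta E.Rval E.qRegion hq = eta E.Rval (E.LGP S) (hS S h) := by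
  constructor
  · rintro ⟨S, hmem, hcls⟩
    exact ⟨S, hmem, (eta_eq_eta_iff E.Rval _ _ hq (hS S hmem)).mpr hcls⟩
  · rintro ⟨S, hmem, heq⟩
    exact ⟨S, hmem, (eta_eq_eta_iff E.Rval _ _ hq (hS S hmem)).mp heq⟩

/-- **(9-1) ⟹ Cor. 3.12's inequality, at measure level** (LANA p. 44: "We believe that if the problem
described in the "main goal" below is solved, then Corollary 3.12 … will follow"; §8.3: "the set of
procession-normalized log-volumes of the admissible output regions contains the `q`-pilot log-volume …
That is, `−|log(q)| ∈ ℝ_{≤−|log(Θ)|}` … this means `−|log(q)| ≤ −|log(Θ)|`"): IF every suitable `LGP·S` lies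
inside the hull (§8.1 (f): the hull is taken of the union of the possible images), THEN (9-1) gives
`−|log(q)| ≤ −|log(Θ)|` by monotonicity of the measure. [cite: LANA2026Report, §8.3 p. 43, §9 p. 44] -/
theorem cor312_of_mainGoal (hsub : ∀ S ∈ E.Suitable, (E.LGP S).carrier ⊆ E.hull.carrier)
    (h : E.MainGoal) : E.negAbsLogq ≤ E.negAbsLogTheta := by
  obtain ⟨S, hmem, hvol⟩ := E.mainGoal_iff_logVol.mp h
  rw [negAbsLogq, ← hvol]
  exact (E.LGP S).logVol_mono E.hull (hsub S hmem)

/-- Vacuity check 1: with NO suitable `S` ((Ind3) grants nothing) (9-1) fails — (9-1) is not automatic.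
[cite: LANA2026Report, Rem. 8.2.1 p. 42] -/
theorem not_mainGoal_of_suitable_empty (h : E.Suitable = ∅) : ¬ E.MainGoal := by
  rintro ⟨S, hmem, -⟩
  rw [h] at hmem
  exact hmem

/-- Vacuity check 2: if some suitable `LGP·S` has the volume of the `q`-region, (9-1) holds — (9-1) is a
statement about WHICH `S` are suitable, i.e. about (Ind1)–(Ind3) (LANA §10.4 p. 49: "the indeterminacies
create ambiguities in the choice of the set `S` in (9-1)"). [cite: LANA2026Report, §10.4 p. 49] -/
theorem mainGoal_of_mem {S : Region μ} (hS : S ∈ E.Suitable) (hvol : (E.LGP S).vol = E.qRegion.vol) :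
    E.MainGoal :=
  ⟨S, hS, ((E.qRegion.cls_eq_cls_iff (E.LGP S)).mpr hvol.symm)⟩

end EtaData

end IUTFork

end Summit.ABC

end
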